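import Literature.NumberTheory.Transcendental.KZMellinFibres
import Literature.NumberTheory.Transcendental.KZProductIdeal
import Literature.NumberTheory.Transcendental.KZLogCalculusProofs
import Literature.Analysis.SpecialFunctions.SelbergIntegralBasic
import HarnessLib

/-!
# Dirichlet's simplex integral peeled onto Beta products inside the Kontsevich–Zagier rules

For `m ≥ 0` and rational `s, c` write `Δ_m = {u ∈ ℝ^m | u_i > 0, Σ u_i < 1}` (open standard simplex)
and `D_m(s; c) = [Δ_m, (∏ u_i^{s-1}) (1 - Σ u_i)^{c-1}]` (Dirichlet's integral, value
`Γ(s)^m Γ(c) / Γ(ms + c)`, Andrews–Askey–Roy 1999, Thm 1.8.1). Inside the calculus of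
Kontsevich–Zagier (2001, §1.2), for representations PINNED by domain and integrand:

* `KZ.dirichletPeel_equivalent` — **peeling** `D_{m+1}(s; c) ∼ D_m(s; c+s) × β(s, c)`: ONE change
  of variables `(u', t) ↦ (u', (1 - Σ u') t)` of `Δ_m × (0,1)` onto `Δ_{m+1}` (`|det| = 1 - Σ u'`,
  `LinearMap.det_of_snoc_init`), the chart being `KZ.exists_dirichletPeelChart`;
* `KZ.exists_dirichletRep`, `KZ.exists_betaRep'` — the representations `D_m(s; c)`, `β(a, b)` EXIST
  for positive parameters (integrability transported along the chart by Mathlib's Jacobian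
  criterion, starting from Euler's Beta integral).

With `KZ.dirichletOne_equivalent_beta` (`D_1(s; c) ∼ β(s, c)`, file `KZDirichletScaling`) this
gives `D_m(s; s) ∼ β(s, ms) × ⋯ × β(s, 2s) × β(s, s)`, the simplex side of Gauss's multiplication
formula in Beta form (Andrews–Askey–Roy 1999, Thm 1.5.2). Everything is proved; no `def`, no
named fact.
-/
noncomputable section

open MeasureTheory Set
open Literature.ModelTheory.ExponentialFields (IsSemialgebraic isSemialgebraic_setOf_eval_pos)
open MvPolynomial (aeval X C)

namespace Literature.NumberTheory.Transcendental

namespace KZ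

variable {m : ℕ}

/-! ## The standard simplex and the Dirichlet integrand -/

/-- The open standard simplex `Δ_m = {u > 0, Σ u < 1}` is `ℚ`-semialgebraic. [folklore] -/
theorem isSemialgebraic_dirichletSimplex (m : ℕ) :
    IsSemialgebraic ℚ {u : Fin m → ℝ | (∀ i, 0 < u i) ∧ ∑ i, u i < 1} := by
  have h := isSemialgebraic_setOf_forall_aeval_pos
    (Fin.snoc (fun i => X i) (1 - ∑ i, X i) : Fin (m + 1) → MvPolynomial (Fin m) ℚ)
  convert h using 1
  ext u
  simp only [mem_setOf_eq, Fin.forall_fin_succ', Fin.snoc_castSucc, Fin.snoc_last, map_sub,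
    map_one, map_sum, MvPolynomial.aeval_X, sub_pos]

/-- The Dirichlet integrand `(∏ u_i^{s-1}) (1 - Σ u_i)^{c-1}` is `ℚ`-semialgebraic on `Δ_m`
(Euler–Mellin, `m + 1` factors). [folklore] -/
theorem isSemialgebraicFunOn_dirichletFun (m : ℕ) (s c : ℚ) :
    IsSemialgebraicFunOn ℚ {u : Fin m → ℝ | (∀ i, 0 < u i) ∧ ∑ i, u i < 1}
      (fun u => (∏ i, (u i) ^ ((s:ℝ) - 1)) * (1 - ∑ i, u i) ^ ((c:ℝ) - 1)) := by
  refine (isSemialgebraicFunOn_mellinIntegrand (isSemialgebraic_dirichletSimplex m)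
    (Fin.snoc (fun i => X i) (1 - ∑ i, X i) : Fin (m + 1) → MvPolynomial (Fin m) ℚ)
    (Fin.snoc (fun _ => s - 1) (c - 1) : Fin (m + 1) → ℚ) 1 (fun u hu k => ?_)).congr fun u _ => ?_
  · refine Fin.lastCases ?_ (fun i => ?_) k
    · simp only [Fin.snoc_last, map_sub, map_one, map_sum, MvPolynomial.aeval_X, sub_pos]
      exact hu.2
    · simp only [Fin.snoc_castSucc, MvPolynomial.aeval_X]
      exact hu.1 i
  · simp only [mellinIntegrand_apply, Fin.prod_univ_castSucc, Fin.snoc_castSucc, Fin.snoc_last,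
      map_sub, map_one, map_sum, MvPolynomial.aeval_X, Rat.cast_one, one_mul, Rat.cast_sub]

/-- The product domain `Δ_m × (0,1) ⊆ ℝ^{m+1}` (last coordinate `t`) is `ℚ`-semialgebraic. [folklore] -/
theorem isSemialgebraic_peelSource (m : ℕ) :
    IsSemialgebraic ℚ {z : Fin (m + 1) → ℝ | ((∀ i : Fin m, 0 < z (Fin.castSucc i)) ∧
      ∑ i : Fin m, z (Fin.castSucc i) < 1) ∧ z (Fin.last m) ∈ Set.Ioo (0:ℝ) 1} := by
  have h1 : IsSemialgebraic ℚ {z : Fin (m + 1) → ℝ |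
      Fin.init z ∈ {u : Fin m → ℝ | (∀ i, 0 < u i) ∧ ∑ i, u i < 1}} :=
    (isSemialgebraic_dirichletSimplex m).setOf_init_mem
  have h2 := isSemialgebraic_setOf_eval_pos (k := ℚ) (R := ℝ)
    (X (Fin.last m) : MvPolynomial (Fin (m + 1)) ℚ)
  have h3 := isSemialgebraic_setOf_eval_pos (k := ℚ) (R := ℝ)
    (1 - X (Fin.last m) : MvPolynomial (Fin (m + 1)) ℚ)
  convert h1.inter (h2.inter h3) using 1
  ext z
  simp only [mem_setOf_eq, mem_inter_iff, mem_Ioo, map_sub, map_one, MvPolynomial.aeval_X, sub_pos,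
    Fin.init]

/-- The last block of `ℝ^m × ℝ^1` is the last coordinate. [folklore] -/
theorem natAdd_fin_one_eq_last (m : ℕ) (j : Fin 1) : (Fin.natAdd m j : Fin (m + 1)) = Fin.last m := by
  ext
  simp

/-- The scalar identity behind the peeling chart `(u', t) ↦ (u', (1 - S) t)`, `S = Σ u'`:
`P ((1-S)t)^{a-1} (1 - S - (1-S)t)^{b-1} (1-S) = P (1-S)^{b+a-1} · t^{a-1}(1-t)^{b-1}`. [folklore] -/
theorem peel_scalar_identity (a b P : ℝ) {S t : ℝ} (hS : S < 1) (ht : 0 < t) (ht1 : t < 1) :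
    P * ((1 - S) * t) ^ (a - 1) * (1 - (S + (1 - S) * t)) ^ (b - 1) * (1 - S) =
      P * (1 - S) ^ (b + a - 1) * (t ^ (a - 1) * (1 - t) ^ (b - 1)) := by
  have h1S : 0 < 1 - S := by linarith
  have h1t : 0 < 1 - t := by linarith
  have e : 1 - (S + (1 - S) * t) = (1 - S) * (1 - t) := by ring
  rw [e, Real.mul_rpow h1S.le ht.le, Real.mul_rpow h1S.le h1t.le]
  have h' : (1 - S) ^ (b + a - 1) = (1 - S) ^ (a - 1) * (1 - S) ^ (b - 1) * (1 - S) := by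
    rw [← Real.rpow_add h1S, ← Real.rpow_add_one h1S.ne']
    congr 1
    ring
  rw [h']
  ring

/-! ## The product `D_m(s; c+s) × β(s, c)` read in coordinates -/

/-- The domain of `D' × B`, for `D'` pinned on `Δ_m` and `B` pinned on `(0,1)`, is `Δ_m × (0,1)`
(`castAdd 1 = castSucc`, `natAdd m 0 = last m`). [folklore] -/
theorem prodDomain_dirichlet_beta (D' : IntegralRep m) (B : IntegralRep 1)
    (hD'd : D'.domain = {u | (∀ i, 0 < u i) ∧ ∑ i, u i < 1})
    (hBd : B.domain = {t | t 0 ∈ Set.Ioo (0:ℝ) 1}) :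
    IntegralRep.prodDomain D' B = {z : Fin (m + 1) → ℝ | ((∀ i : Fin m, 0 < z (Fin.castSucc i)) ∧
      ∑ i : Fin m, z (Fin.castSucc i) < 1) ∧ z (Fin.last m) ∈ Set.Ioo (0:ℝ) 1} := by
  ext z
  simp only [IntegralRep.mem_prodDomain, hD'd, hBd, mem_setOf_eq, natAdd_fin_one_eq_last]
  exact Iff.rfl

/-- **The pull-back identity.** For `D'` pinned as `D_m(s; c+s)` and `B` pinned as `β(s, c)`, on
`Δ_m × (0,1)` the product integrand `D' ⊗ B` is the Dirichlet integrand of `D_{m+1}(s; c)` at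
`(u', (1 - Σu') t)` times the Jacobian `1 - Σ u'`. [cite: AndrewsAskeyRoy1999, Thm 1.8.1] -/
theorem prodFun_dirichlet_beta (s c : ℚ) (D' : IntegralRep m) (B : IntegralRep 1)
    (hD'd : D'.domain = {u | (∀ i, 0 < u i) ∧ ∑ i, u i < 1})
    (hD'i : Set.EqOn D'.integrand
      (fun u => (∏ i, (u i) ^ ((s:ℝ) - 1)) * (1 - ∑ i, u i) ^ (((c + s : ℚ):ℝ) - 1)) D'.domain)
    (hBd : B.domain = {t | t 0 ∈ Set.Ioo (0:ℝ) 1})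
    (hBi : Set.EqOn B.integrand (fun t => (t 0) ^ ((s:ℝ) - 1) * (1 - t 0) ^ ((c:ℝ) - 1)) B.domain)
    {z : Fin (m + 1) → ℝ}
    (hz : z ∈ {z : Fin (m + 1) → ℝ | ((∀ i : Fin m, 0 < z (Fin.castSucc i)) ∧
      ∑ i : Fin m, z (Fin.castSucc i) < 1) ∧ z (Fin.last m) ∈ Set.Ioo (0:ℝ) 1}) :
    IntegralRep.prodFun D' B z =
      (∏ j, ((Fin.snoc (fun i => z (Fin.castSucc i)) ((1 - ∑ i, z (Fin.castSucc i)) * z (Fin.last m)) :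
          Fin (m + 1) → ℝ) j) ^ ((s:ℝ) - 1)) *
        (1 - ∑ j, (Fin.snoc (fun i => z (Fin.castSucc i)) ((1 - ∑ i, z (Fin.castSucc i)) * z (Fin.last m)) :
          Fin (m + 1) → ℝ) j) ^ ((c:ℝ) - 1) *
        (1 - ∑ i, z (Fin.castSucc i)) := by
  obtain ⟨⟨hpos, hsum⟩, ht⟩ := hz
  have h1 : (fun i => z (Fin.castAdd 1 i)) ∈ D'.domain := by
    rw [hD'd]
    exact ⟨hpos, hsum⟩
  have h2 : (fun j => z (Fin.natAdd m j)) ∈ B.domain := by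
    rw [hBd]
    show z (Fin.natAdd m 0) ∈ Set.Ioo (0:ℝ) 1
    rw [natAdd_fin_one_eq_last]
    exact ht
  rw [IntegralRep.prodFun_apply, hD'i h1, hBi h2]
  beta_reduce
  rw [natAdd_fin_one_eq_last, Fin.prod_univ_castSucc, Fin.sum_snoc]
  simp only [Fin.snoc_castSucc, Fin.snoc_last, Rat.cast_add]
  exact (peel_scalar_identity (s:ℝ) (c:ℝ) _ hsum ht.1 ht.2).symm

/-! ## The peeling chart -/

/-- **The peeling chart** `Ψ(u', t) = (u', (1 - Σ u') t)` of `Δ_{m+1}` by `Δ_m × (0,1)` (last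
coordinate `t`): a `ℚ`-polynomial map, differentiable with `det DΨ = 1 - Σ u'` (block triangular,
`LinearMap.det_of_snoc_init`), injective on `Δ_m × (0,1)` and ONTO `Δ_{m+1}` (inverse
`t = u_{m+1} / (1 - Σ_{i ≤ m} u_i)`). [folklore] -/
theorem exists_dirichletPeelChart (m : ℕ) :
    ∃ (Ψ : (Fin (m + 1) → ℝ) → (Fin (m + 1) → ℝ))
      (Ψ' : (Fin (m + 1) → ℝ) → (Fin (m + 1) → ℝ) →L[ℝ] (Fin (m + 1) → ℝ)),
      (∀ z, Ψ z = Fin.snoc (fun i => z (Fin.castSucc i))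
        ((1 - ∑ i, z (Fin.castSucc i)) * z (Fin.last m))) ∧
      IsSemialgebraicMapOn ℚ {z : Fin (m + 1) → ℝ | ((∀ i : Fin m, 0 < z (Fin.castSucc i)) ∧
          ∑ i : Fin m, z (Fin.castSucc i) < 1) ∧ z (Fin.last m) ∈ Set.Ioo (0:ℝ) 1} Ψ ∧
      (∀ z, HasFDerivAt Ψ (Ψ' z) z) ∧
      Set.InjOn Ψ {z : Fin (m + 1) → ℝ | ((∀ i : Fin m, 0 < z (Fin.castSucc i)) ∧
          ∑ i : Fin m, z (Fin.castSucc i) < 1) ∧ z (Fin.last m) ∈ Set.Ioo (0:ℝ) 1} ∧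
      Ψ '' {z : Fin (m + 1) → ℝ | ((∀ i : Fin m, 0 < z (Fin.castSucc i)) ∧
          ∑ i : Fin m, z (Fin.castSucc i) < 1) ∧ z (Fin.last m) ∈ Set.Ioo (0:ℝ) 1} =
        {u : Fin (m + 1) → ℝ | (∀ j, 0 < u j) ∧ ∑ j, u j < 1} ∧
      (∀ z, (Ψ' z).det = 1 - ∑ i, z (Fin.castSucc i)) := by
  -- the substitution
  set Ψ : (Fin (m + 1) → ℝ) → (Fin (m + 1) → ℝ) := fun z =>
    Fin.snoc (fun i => z (Fin.castSucc i)) ((1 - ∑ i, z (Fin.castSucc i)) * z (Fin.last m)) with hΨ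
  -- continuous linear pieces
  let lastL : (Fin (m + 1) → ℝ) →L[ℝ] ℝ := ContinuousLinearMap.proj (Fin.last m)
  let sumL : (Fin (m + 1) → ℝ) →L[ℝ] ℝ :=
    ∑ i : Fin m, ContinuousLinearMap.proj (R := ℝ) (φ := fun _ : Fin (m + 1) => ℝ) (Fin.castSucc i)
  have hsumL : ∀ w, sumL w = ∑ i, w (Fin.castSucc i) := fun w => by simp [sumL]
  have hlastL : ∀ w, lastL w = w (Fin.last m) := fun w => rfl
  let row : (Fin (m + 1) → ℝ) → (Fin (m + 1) → ℝ) →L[ℝ] ℝ := fun z =>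
    (1 - ∑ i, z (Fin.castSucc i)) • lastL - z (Fin.last m) • sumL
  have hrow : ∀ z w, row z w =
      (1 - ∑ i, z (Fin.castSucc i)) * w (Fin.last m) - z (Fin.last m) * ∑ i, w (Fin.castSucc i) := by
    intro z w
    simp [row, hsumL, hlastL]
  let Ψ' : (Fin (m + 1) → ℝ) → (Fin (m + 1) → ℝ) →L[ℝ] (Fin (m + 1) → ℝ) := fun z =>
    ContinuousLinearMap.pi
      (Fin.lastCases (motive := fun _ => (Fin (m + 1) → ℝ) →L[ℝ] ℝ) (row z)
        (fun i => ContinuousLinearMap.proj (Fin.castSucc i)))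
  have hΨ' : ∀ z w, Ψ' z w = Fin.snoc (Fin.init w) (row z w) := by
    intro z w
    funext i
    refine Fin.lastCases ?_ (fun j => ?_) i
    · simp [Ψ']
    · simp [Ψ', Fin.init]
  -- determinant
  have hdet : ∀ z, (Ψ' z).det = 1 - ∑ i, z (Fin.castSucc i) := by
    intro z
    have h := LinearMap.det_of_snoc_init (Ψ' z : (Fin (m + 1) → ℝ) →ₗ[ℝ] (Fin (m + 1) → ℝ))
      LinearMap.id ((-z (Fin.last m)) • ∑ i : Fin m, LinearMap.proj i)
      (1 - ∑ i, z (Fin.castSucc i)) (fun w => by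
        rw [ContinuousLinearMap.coe_coe, hΨ', hrow, LinearMap.id_apply]
        congr 1
        simp [Fin.init]
        ring)
    rw [LinearMap.det_id, mul_one] at h
    exact h
  -- derivative
  have hderiv : ∀ z, HasFDerivAt Ψ (Ψ' z) z := by
    intro z
    rw [hasFDerivAt_pi']
    intro i
    refine Fin.lastCases ?_ (fun j => ?_) i
    · have hs : HasFDerivAt (fun x : Fin (m + 1) → ℝ => ∑ i, x (Fin.castSucc i)) sumL z :=
        HasFDerivAt.fun_sum fun i _ => hasFDerivAt_apply (Fin.castSucc i) z
      have hl : HasFDerivAt (fun x : Fin (m + 1) → ℝ => x (Fin.last m)) lastL z :=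
        hasFDerivAt_apply (Fin.last m) z
      have h := (hs.const_sub 1).mul hl
      have hfun : (fun x => Ψ x (Fin.last m)) =
          fun x => (1 - ∑ i, x (Fin.castSucc i)) * x (Fin.last m) := by
        funext x
        simp [hΨ]
      rw [hfun]
      refine h.congr_fderiv (ContinuousLinearMap.ext fun w => ?_)
      simp only [ContinuousLinearMap.coe_comp, Function.comp_apply, hΨ', hrow]
      simp [hsumL, hlastL]
      ring
    · have hfun : (fun x => Ψ x (Fin.castSucc j)) = fun x => x (Fin.castSucc j) := by
        funext x
        simp [hΨ]
      rw [hfun]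
      refine (hasFDerivAt_apply (Fin.castSucc j) z).congr_fderiv
        (ContinuousLinearMap.ext fun w => ?_)
      simp [hΨ', Fin.init]
  refine ⟨Ψ, Ψ', fun z => rfl, ?_, hderiv, ?_, ?_, hdet⟩
  · -- semialgebraic: a polynomial map
    refine (isSemialgebraicMapOn_aeval (isSemialgebraic_peelSource m)
      (Fin.snoc (fun i => X (Fin.castSucc i)) ((1 - ∑ i, X (Fin.castSucc i)) * X (Fin.last m)) :
        Fin (m + 1) → MvPolynomial (Fin (m + 1)) ℚ)).congr fun z _ => ?_
    funext j
    refine Fin.lastCases ?_ (fun i => ?_) j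
    · simp [hΨ, map_sum]
    · simp [hΨ]
  · -- injective
    intro z₁ _ z₂ hz₂ h
    have hy : ∀ i, z₁ (Fin.castSucc i) = z₂ (Fin.castSucc i) := fun i => by
      have := congrFun h (Fin.castSucc i)
      simpa [hΨ] using this
    have hS : ∑ i, z₁ (Fin.castSucc i) = ∑ i, z₂ (Fin.castSucc i) :=
      Finset.sum_congr rfl fun i _ => hy i
    have hl : (1 - ∑ i, z₁ (Fin.castSucc i)) * z₁ (Fin.last m) =
        (1 - ∑ i, z₂ (Fin.castSucc i)) * z₂ (Fin.last m) := by
      have := congrFun h (Fin.last m)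
      simpa [hΨ] using this
    rw [hS] at hl
    have hpos : 0 < 1 - ∑ i, z₂ (Fin.castSucc i) := sub_pos.2 hz₂.1.2
    have ht : z₁ (Fin.last m) = z₂ (Fin.last m) := mul_left_cancel₀ hpos.ne' hl
    funext j
    exact Fin.lastCases ht (fun i => hy i) j
  · -- image
    ext w
    constructor
    · rintro ⟨z, ⟨⟨hpos, hsum⟩, ht⟩, rfl⟩
      have h1 : 0 < 1 - ∑ i, z (Fin.castSucc i) := sub_pos.2 hsum
      refine ⟨fun j => ?_, ?_⟩
      · refine Fin.lastCases ?_ (fun i => ?_) j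
        · simp only [hΨ, Fin.snoc_last]
          exact mul_pos h1 ht.1
        · simp only [hΨ, Fin.snoc_castSucc]
          exact hpos i
      · simp only [hΨ, Fin.sum_snoc]
        nlinarith [mul_pos h1 (sub_pos.2 ht.2)]
    · rintro ⟨hpos, hsum⟩
      rw [Fin.sum_univ_castSucc] at hsum
      have hl : 0 < w (Fin.last m) := hpos _
      have h1 : 0 < 1 - ∑ i, w (Fin.castSucc i) := by linarith
      refine ⟨Fin.snoc (fun i => w (Fin.castSucc i)) (w (Fin.last m) / (1 - ∑ i, w (Fin.castSucc i))),
        ⟨⟨fun i => ?_, ?_⟩, ?_⟩, ?_⟩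
      · simp only [Fin.snoc_castSucc]
        exact hpos _
      · simp only [Fin.snoc_castSucc]
        linarith
      · simp only [Fin.snoc_last]
        exact ⟨div_pos hl h1, (div_lt_one h1).2 (by linarith)⟩
      · simp only [hΨ, Fin.snoc_castSucc, Fin.snoc_last]
        rw [mul_div_cancel₀ _ h1.ne']
        exact Fin.snoc_init_self w

/-! ## Peeling and existence -/

/-- **Peeling step** `D_{m+1}(s; c) ∼ D_m(s; c+s) × β(s, c)`: for representations PINNED as
`D = [Δ_{m+1}, (∏_{j ≤ m} u_j^{s-1})(1 - Σ u_j)^{c-1}]`, `D' = [Δ_m, (∏ u_i^{s-1})(1 - Σ u_i)^{c+s-1}]`,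
`B = [(0,1), t^{s-1}(1-t)^{c-1}]`, ONE change of variables along the peeling chart
(`exists_dirichletPeelChart`) carries `D' × B` (product representation `KZ.IntegralRep.prod`, its
integrand `D' ⊗ B` by `IntegralRep.prod_integrand_eq`) to `D`. Value identity:
`Γ(s)^{m+1}Γ(c)/Γ((m+1)s+c) = [Γ(s)^m Γ(c+s)/Γ(ms+c+s)] · [Γ(s)Γ(c)/Γ(s+c)]`.
[cite: AndrewsAskeyRoy1999, Thm 1.8.1] -/
theorem dirichletPeel_equivalent (s c : ℚ) (D : IntegralRep (m + 1)) (D' : IntegralRep m)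
    (B : IntegralRep 1)
    (hDd : D.domain = {u | (∀ j, 0 < u j) ∧ ∑ j, u j < 1})
    (hDi : Set.EqOn D.integrand
      (fun u => (∏ j, (u j) ^ ((s:ℝ) - 1)) * (1 - ∑ j, u j) ^ ((c:ℝ) - 1)) D.domain)
    (hD'd : D'.domain = {u | (∀ i, 0 < u i) ∧ ∑ i, u i < 1})
    (hD'i : Set.EqOn D'.integrand
      (fun u => (∏ i, (u i) ^ ((s:ℝ) - 1)) * (1 - ∑ i, u i) ^ (((c + s : ℚ):ℝ) - 1)) D'.domain)
    (hBd : B.domain = {t | t 0 ∈ Set.Ioo (0:ℝ) 1})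
    (hBi : Set.EqOn B.integrand (fun t => (t 0) ^ ((s:ℝ) - 1) * (1 - t 0) ^ ((c:ℝ) - 1)) B.domain) :
    Equivalent D (D'.prod B) := by
  obtain ⟨Ψ, Ψ', hΨ, hsa, hderiv, hinj, himage, hdet⟩ := exists_dirichletPeelChart m
  have hdom : (D'.prod B).domain = {z : Fin (m + 1) → ℝ | ((∀ i : Fin m, 0 < z (Fin.castSucc i)) ∧
      ∑ i : Fin m, z (Fin.castSucc i) < 1) ∧ z (Fin.last m) ∈ Set.Ioo (0:ℝ) 1} :=
    prodDomain_dirichlet_beta D' B hD'd hBd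
  have hmem : of (D'.prod B) - of D ∈ changeOfVariablesRel := by
    refine ⟨m + 1, D'.prod B, D, Ψ, Ψ', by rw [hdom]; exact hsa,
      fun x _ => (hderiv x).hasFDerivWithinAt, by rw [hdom]; exact hinj,
      by rw [hdom, hDd, himage], fun z hz => ?_, rfl⟩
    rw [hdom] at hz
    have hΨz : Ψ z ∈ D.domain := by
      rw [hDd, ← himage]
      exact mem_image_of_mem Ψ hz
    rw [IntegralRep.prod_integrand_eq, prodFun_dirichlet_beta s c D' B hD'd hD'i hBd hBi hz, hDi hΨz,
      hdet z, abs_of_pos (sub_pos.2 hz.1.2), hΨ z]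
  exact Equivalent.symm (changeOfVariablesRel_subset_relations hmem)

/-- Euler's Beta representation `[(0,1), t^{a-1}(1-t)^{b-1}]` EXISTS for rational `a, b > 0`
(Euler–Mellin semialgebraic; integrable by the Beta integral). [cite: AndrewsAskeyRoy1999, Def. 1.1.3] -/
theorem exists_betaRep' (a b : ℚ) (ha : 0 < a) (hb : 0 < b) :
    ∃ B : IntegralRep 1, B.domain = {t | t 0 ∈ Set.Ioo (0:ℝ) 1} ∧
      B.integrand = fun t => (t 0) ^ ((a:ℝ) - 1) * (1 - t 0) ^ ((b:ℝ) - 1) := by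
  have hdom : IsSemialgebraic ℚ {t : Fin 1 → ℝ | t 0 ∈ Set.Ioo (0:ℝ) 1} := by
    convert KZ.isSemialgebraic_box 1 using 1
    ext x
    simp [Fin.forall_fin_one]
  have hsa : IsSemialgebraicFunOn ℚ {t : Fin 1 → ℝ | t 0 ∈ Set.Ioo (0:ℝ) 1}
      (fun t => (t 0) ^ ((a:ℝ) - 1) * (1 - t 0) ^ ((b:ℝ) - 1)) := by
    refine (isSemialgebraicFunOn_mellinIntegrand hdom ![X 0, 1 - X 0] ![a - 1, b - 1] 1
      (fun x hx k => ?_)).congr fun x _ => ?_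
    · have hx' : 0 < x 0 ∧ x 0 < 1 := hx
      fin_cases k
      · simpa using hx'.1
      · simp only [Fin.mk_one, Matrix.cons_val_one, Matrix.cons_val_fin_one, map_sub, map_one,
          MvPolynomial.aeval_X, sub_pos]
        exact hx'.2
    · simp [mellinIntegrand_apply, Fin.prod_univ_two]
  -- adapted from `KZ.integrableOn_setOf_apply_mem_iff` (KZBetaChains): transport along `ℝ¹ ≃ ℝ`
  have hint : IntegrableOn (fun t : Fin 1 → ℝ => (t 0) ^ ((a:ℝ) - 1) * (1 - t 0) ^ ((b:ℝ) - 1))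
      {t | t 0 ∈ Set.Ioo (0:ℝ) 1} := by
    have h := (Literature.Analysis.SpecialFunctions.Selberg.integrableOn_Ioo_rpow_mul_one_sub_rpow_and_integral_eq
      (a := a) (b := b) (by exact_mod_cast ha) (by exact_mod_cast hb)).1
    exact ((volume_preserving_funUnique (Fin 1) ℝ).integrableOn_comp_preimage
      (MeasurableEquiv.funUnique (Fin 1) ℝ).measurableEmbedding).2 h
  exact ⟨⟨_, _, hdom, hsa, hint⟩, rfl, rfl⟩

/-- **The Dirichlet representations exist**: for rational `s, c > 0` and every `m` there is a
representation with domain `Δ_m` and integrand `(∏ u_i^{s-1})(1 - Σ u_i)^{c-1}` (by induction on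
`m`: absolute convergence on `Δ_{m+1}` is that of `D_m(s; c+s) ⊗ β(s, c)` on `Δ_m × (0,1)` pulled
through the peeling chart, Mathlib's `integrableOn_image_iff_integrableOn_abs_det_fderiv_smul`;
`Δ_0` is a point). [cite: AndrewsAskeyRoy1999, Thm 1.8.1] -/
theorem exists_dirichletRep (s : ℚ) (hs : 0 < s) : ∀ (m : ℕ) (c : ℚ), 0 < c →
    ∃ D : IntegralRep m, D.domain = {u | (∀ i, 0 < u i) ∧ ∑ i, u i < 1} ∧
      D.integrand = fun u => (∏ i, (u i) ^ ((s:ℝ) - 1)) * (1 - ∑ i, u i) ^ ((c:ℝ) - 1)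
  | 0, c, _ => by
    refine ⟨⟨_, _, isSemialgebraic_dirichletSimplex 0, isSemialgebraicFunOn_dirichletFun 0 s c, ?_⟩,
      rfl, rfl⟩
    have hf : (fun u : Fin 0 → ℝ => (∏ i, (u i) ^ ((s:ℝ) - 1)) * (1 - ∑ i, u i) ^ ((c:ℝ) - 1)) =
        fun _ => 1 := by
      funext u
      simp
    rw [hf]
    refine integrableOn_const ?_
    refine ne_top_of_le_ne_top ?_ (measure_mono (subset_univ _))
    rw [volume_pi, Measure.pi_univ]
    simp
  | m + 1, c, hc => by
    obtain ⟨D', hD'd, hD'i⟩ := exists_dirichletRep s hs m (c + s) (add_pos hc hs)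
    obtain ⟨B, hBd, hBi⟩ := exists_betaRep' s c hs hc
    obtain ⟨Ψ, Ψ', hΨ, -, hderiv, hinj, himage, hdet⟩ := exists_dirichletPeelChart m
    have hdom := prodDomain_dirichlet_beta D' B hD'd hBd
    have hmeas : MeasurableSet {z : Fin (m + 1) → ℝ | ((∀ i : Fin m, 0 < z (Fin.castSucc i)) ∧
        ∑ i : Fin m, z (Fin.castSucc i) < 1) ∧ z (Fin.last m) ∈ Set.Ioo (0:ℝ) 1} :=
      hdom ▸ IntegralRep.measurableSet_domain_holds (D'.prod B)
    refine ⟨⟨_, _, isSemialgebraic_dirichletSimplex (m + 1), isSemialgebraicFunOn_dirichletFun (m + 1) s c,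
      ?_⟩, rfl, rfl⟩
    rw [← himage, integrableOn_image_iff_integrableOn_abs_det_fderiv_smul volume hmeas
      (fun x _ => (hderiv x).hasFDerivWithinAt) hinj]
    have h1 := IntegralRep.integrableOn_prodFun D' B
    rw [hdom] at h1
    refine h1.congr_fun (fun z hz => ?_) hmeas
    rw [prodFun_dirichlet_beta s c D' B hD'd (fun u _ => by rw [hD'i]) hBd (fun t _ => by rw [hBi]) hz,
      smul_eq_mul, hdet z, abs_of_pos (sub_pos.2 hz.1.2), hΨ z]
    ring

end KZ

end Literature.NumberTheory.Transcendental
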